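import Mathlib
import HarnessLib
import Summits.CriticalPhenomena.SAWScalingLimit.Theorems.SAWSpinMonotoneQCIdentificationDefs
import Summits.CriticalPhenomena.SAWScalingLimit.Theorems.SAWSpinMonotoneQCIdentificationNoBranchingAlgebra
import Summits.CriticalPhenomena.SAWScalingLimit.Theorems.SAWSpinMonotoneQCIdentificationNoBranchingCorners
import Summits.CriticalPhenomena.SAWScalingLimit.Theorems.SAWSpinMonotoneQCIdentificationWindowIdentity
import Summits.CriticalPhenomena.SAWScalingLimit.Theorems.SAWDevelopingMapPotentialExists
import Literature.Probability.LatticeModels.TriangularLatticeProofs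

/-!
# The affine dictionary of the developing map

Helper file (sub-goal L1 of `STUB-REPORT-subsequentialLimits.md` §3; the (K)-consequences and L2, no
collapse, form the companion file `SAWSpinMonotoneQCIdentificationNoCollapse.lean`) of the stubs
`stub_subsequentialLimits` and `stub_rayCondition` of line `eight_fifths_primitive`, crux
`QCIdentification` (stmt-CriticalPhenomena-16772); namespace of the checked skeleton, sub-namespace
`Dev`; vocabulary from `SAWSpinMonotoneQCIdentificationDefs` (`Fobs`, `hexNbr`, `modeSum`) and
`SAWSpinMonotoneQCIdentificationNoBranchingAlgebra`/`…Corners` (`NB.omg = ω = e^{2πi/3}`,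
`NB.dartCoeff`, `NB.hexMidpoint_sub_hexCenter`, `NB.lemma1_mode`, `NB.conj_omg`, `NB.modeBel`); the
potential predicate agrees with the sibling helper's `Window.IsPotential` (`isPotential_iff_window`).

**What.** Let `F = Fobs Λ a` be the critical parafermionic observable of a simply connected
hexagonal domain `Λ` with boundary source `a`, and `H : Site 2 → ℂ` a potential of `F` on the
triangles `Δ_v` (`v ∈ Λ`) of the triangular lattice `𝕋` in the sense of the proved route item
`PotentialExists` (`IsPotential`, `exists_isPotential`). Label the vertices of `Δ_v`
counterclockwise by `triVert v k` (`k : Fin 3`) so that the edge `[triVert v k, triVert v (k+1)]`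
is the one crossed by the mid-edge `p_k = {v, hexNbr v k}`. Then

* (L1a, `increment`, registered `dev_increment`) `H (triVert v (k+1)) - H (triVert v k) =
  (hexMidpoint p_k - hexCenter v) · F(p_k)` for all three `k`;
* (geometry, `edge_eq`, `edge_eq_dart`) the edge vector is
  `triEmbed (triVert v (k+1)) - triEmbed (triVert v k) = faceSign v · ω^{k+1}
  = 2√3 i · (hexMidpoint p_k - hexCenter v)` (`faceSign = ±1` on up/down faces);
* (L1b, `affine`, registered `dev_affine`) **the affine dictionary**: with the explicit constants
  `cAlpha = (1 + ζ)ω²/18 = -i√3/18 = 1/(6√3 i)` and `cBeta = (1 + ζ)ω/18 = -1/12 + i√3/36 = -ζ cAlpha`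
  (`|cAlpha| = |cBeta| = √3/18`), `alpha F v = cAlpha · modeSum F v` and
  `beta F v = cBeta · belt F v`, `belt F v = F(p₀) + ω² F(p₁) + ω F(p₂)` the Beltrami mode,
  every increment of `H` along an edge `e` of `Δ_v` equals `alpha · e + beta · ē`: `H` is the
  real-affine map `z ↦ alpha z + beta z̄ + γ` on `Δ_v`, i.e. `∂H = cAlpha · S(v)`
  ("`ΣF = 6√3 i ∂H`") and `∂̄H = cBeta · B(v)`. The third Fourier mode is killed by DCS Lemma 1
  (`NB.lemma1_mode`), and the identity is then polynomial algebra in `ω` (`affine_alg`);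
* (companion file) under the no-fold bound (K): `‖belt F v‖ ≤ k ‖modeSum F v‖`, hence
  `‖beta F v‖ ≤ k ‖alpha F v‖` (the affine pieces are uniformly `K`-quasiconformal,
  `K = (1+k)/(1-k)`), and `S(v) ≠ 0` on the whole source component of `Λ` (no collapse).

Sources: H. Duminil-Copin, S. Smirnov, *The connective constant of the honeycomb lattice equals
`√(2+√2)`*, Ann. of Math. 175 (2012) 1653–1665 (arXiv:1007.0575), Lemma 1 and its proof (the
three "pair/triplet" contributions; here only the statement, via the tree theorem); S. Smirnov,
*Discrete complex analysis and probability*, Proc. ICM 2010, §2 (discrete `∂`, `∂̄` on the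
triangular/hexagonal pair). The dictionary itself is elementary linear algebra of a real-affine
map on an equilateral triangle (docstring of `PotentialExists`).
-/

noncomputable section

open Complex
open scoped ComplexConjugate
open Literature.Probability.LatticeModels Literature.Probability.RandomPlanarGeometry.SAW
open Summit.CriticalPhenomena.SAWScalingLimit.Theses.SAWDevelopingMap
open Summit.CriticalPhenomena.SAWScalingLimit.Theorems (potentialExists_proof)
open Summit.CriticalPhenomena.SAWScalingLimit.Theorems.PotentialExists (oriented_up_fst
  oriented_up_snd oriented_up_thd oriented_down_fst oriented_down_snd oriented_down_thd)

namespace Summit.CriticalPhenomena.SAWScalingLimit.Cruxes.QCIdentification.EightFifthsPrimitive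

namespace Dev

open NB

/-! ### One more fact about `ω = e^{2πi/3}` (`NB.omg`; `conj ω = ω²` is `NB.conj_omg`) -/

/-- `ζ = 1 + ω`. -/
theorem triZeta_eq_one_add_omg : triZeta = 1 + omg := by
  rw [triZeta_eq, omg_eq]
  apply Complex.ext <;> norm_num

/-! ### The Beltrami mode -/

/-- The **Beltrami mode** of a mid-edge function around a vertex, for the counterclockwise
labelling `hexNbr`: `B(v) = F(p₀) + ω² F(p₁) + ω F(p₂)` (`= F(p₀) + ω F(p₂) + ω² F(p₁)`, the
`ω`-mode of the clockwise labelling; the `ω`-mode of the counterclockwise labelling vanishes by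
DCS Lemma 1, `NB.lemma1_mode`). On the triangle `Δ_v` it is `∂̄H` up to the constant `cBeta`. -/
def belt (F : Sym2 HexVertex → ℂ) (v : HexVertex) : ℂ :=
  F s(v, hexNbr v 0) + omg ^ 2 * F s(v, hexNbr v 1) + omg * F s(v, hexNbr v 2)

/-- `belt` is the Beltrami mode `NB.modeBel` of the corner-angle file (same value, summands in the
clockwise order `F(p₀) + ω F(p₂) + ω² F(p₁)` there). -/
theorem belt_eq_modeBel (F : Sym2 HexVertex → ℂ) (v : HexVertex) : belt F v = modeBel F v := by
  unfold belt modeBel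
  ring

/-! ### Potentials -/

/-- **`H` is a potential of `F = Fobs Λ a` on the triangles of `Λ`**: verbatim the body of the
route statement `PotentialExists` after `∃ H` — for every `v ∈ Λ`, every neighbour `w` and the
common `𝕋`-edge `{s, t}` oriented with the centre of `v` on its left,
`H t - H s = (hexMidpoint {v, w} - hexCenter v) · F{v, w}`. -/
def IsPotential (Λ : Finset HexVertex) (a : Sym2 HexVertex) (H : Site 2 → ℂ) : Prop :=
  ∀ v ∈ Λ, ∀ w : HexVertex, hexGraph.Adj v w → ∀ s t : Site 2, s ∈ hexFaceVertices v →
    t ∈ hexFaceVertices v → s ∈ hexFaceVertices w → t ∈ hexFaceVertices w → s ≠ t →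
    0 < ((starRingEnd ℂ) (triEmbed t - triEmbed s) * (hexCenter v - triEmbed s)).im →
    H t - H s = (hexMidpoint s(v, w) - hexCenter v) *
      hexParafermionicObservable Λ a hexCriticalFugacity (5 / 8) s(v, w)

/-- `Dev.IsPotential` is the sibling helper's `Window.IsPotential` (definitional: `Fobs` is an
`abbrev`). -/
theorem isPotential_iff_window (Λ : Finset HexVertex) (a : Sym2 HexVertex) (H : Site 2 → ℂ) :
    IsPotential Λ a H ↔ Window.IsPotential Λ a H :=
  Iff.rfl

/-- Potentials exist (the proved route item `PotentialExists`, `potentialExists_proof`). -/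
theorem exists_isPotential {Λ : Finset HexVertex} (hΛ : hexDomainSimplyConnected Λ)
    {a : Sym2 HexVertex} (ha : a ∈ hexDomainBoundary Λ) : ∃ H : Site 2 → ℂ, IsPotential Λ a H :=
  potentialExists_proof Λ hΛ a ha

/-! ### The triangle `Δ_v` -/

/-- The three vertices of the triangle `Δ_v` of `𝕋` dual to the hexagonal-lattice vertex `v`,
listed counterclockwise and indexed compatibly with `hexNbr`: the `𝕋`-edge
`[triVert v k, triVert v (k + 1)]` is the one crossed by the mid-edge `{v, hexNbr v k}` (and the
centre of `v` lies to its left). Up face `(x, 0)`: `x + e₀, x + e₁, x`; down face `(x, 1)`: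
`x + e₁, x + e₀, x + e₀ + e₁`. -/
def triVert (v : HexVertex) (k : Fin 3) : Site 2 :=
  if v.2 = 0 then ![v.1 + Pi.single 0 1, v.1 + Pi.single 1 1, v.1] k
  else ![v.1 + Pi.single 1 1, v.1 + Pi.single 0 1, v.1 + Pi.single 0 1 + Pi.single 1 1] k

/-- The vertices `triVert v k` are vertices of the face `v`. -/
theorem triVert_mem (v : HexVertex) (k : Fin 3) : triVert v k ∈ hexFaceVertices v := by
  obtain ⟨x, t⟩ := v
  fin_cases t <;> fin_cases k <;> simp [triVert, hexFaceVertices]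

/-- `triVert v k` is a vertex of the neighbouring face `hexNbr v k`. -/
theorem triVert_mem_nbr (v : HexVertex) (k : Fin 3) :
    triVert v k ∈ hexFaceVertices (hexNbr v k) := by
  obtain ⟨x, t⟩ := v
  fin_cases t <;> fin_cases k <;>
    simp [triVert, hexNbr, hexFaceVertices, site_two_eq_iff]

/-- `triVert v (k + 1)` is a vertex of the neighbouring face `hexNbr v k`. -/
theorem triVert_succ_mem_nbr (v : HexVertex) (k : Fin 3) :
    triVert v (k + 1) ∈ hexFaceVertices (hexNbr v k) := by
  obtain ⟨x, t⟩ := v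
  fin_cases t <;> fin_cases k <;>
    simp [triVert, hexNbr, hexFaceVertices, site_two_eq_iff]

/-- Consecutive vertices of `Δ_v` are distinct. -/
theorem triVert_ne_succ (v : HexVertex) (k : Fin 3) : triVert v k ≠ triVert v (k + 1) := by
  obtain ⟨x, t⟩ := v
  fin_cases t <;> fin_cases k <;> simp [triVert, site_two_eq_iff]

/-- The centre of `v` lies to the left of the oriented edge `triVert v k → triVert v (k + 1)`. -/
theorem triVert_oriented (v : HexVertex) (k : Fin 3) :
    0 < (conj (triEmbed (triVert v (k + 1)) - triEmbed (triVert v k)) *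
      (hexCenter v - triEmbed (triVert v k))).im := by
  obtain ⟨x, t⟩ := v
  fin_cases t <;> fin_cases k
  · simpa [triVert] using oriented_up_snd x
  · simpa [triVert] using oriented_up_thd x
  · simpa [triVert] using oriented_up_fst x
  · simpa [triVert] using oriented_down_thd x
  · simpa [triVert] using oriented_down_fst x
  · simpa [triVert, add_assoc] using oriented_down_snd x

/-- The orientation sign of a face: `+1` for up faces, `-1` for down faces. -/
def faceSign (v : HexVertex) : ℂ := if v.2 = 0 then 1 else -1

/-- `conj (faceSign v) = faceSign v`. -/
theorem conj_faceSign (v : HexVertex) : conj (faceSign v) = faceSign v := by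
  unfold faceSign; split_ifs <;> simp

/-- `‖faceSign v‖ = 1`. -/
theorem norm_faceSign (v : HexVertex) : ‖faceSign v‖ = 1 := by
  unfold faceSign; split_ifs <;> simp

/-- The dart coefficient is `faceSign v · (1 + ζ)/6`. -/
theorem dartCoeff_eq (v : HexVertex) : dartCoeff v = faceSign v * ((1 + triZeta) / 6) := by
  unfold dartCoeff faceSign
  split_ifs <;> ring

/-- **The edge vectors of `Δ_v`**: `triVert v (k+1) - triVert v k ↦ faceSign v · ω^{k+1}`. -/
theorem edge_eq (v : HexVertex) (k : Fin 3) :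
    triEmbed (triVert v (k + 1)) - triEmbed (triVert v k) = faceSign v * omg ^ ((k : ℕ) + 1) := by
  have hp := one_add_omg_add_sq
  obtain ⟨x, t⟩ := v
  fin_cases t <;> fin_cases k <;>
    simp [triVert, faceSign, triEmbed_add, triZeta_eq_one_add_omg]
  · linear_combination (-1 : ℂ) * hp
  · linear_combination (1 - omg) * hp
  · linear_combination hp
  · linear_combination (1 - omg) * hp

/-- `2√3 · i · (1 + ζ) = 6 ω`. -/
theorem two_sqrt_three_I_mul : 2 * (Real.sqrt 3 : ℂ) * I * (1 + triZeta) = 6 * omg := by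
  have h3 : Real.sqrt 3 * Real.sqrt 3 = 3 := Real.mul_self_sqrt (by norm_num)
  rw [triZeta_eq, omg_eq]
  apply Complex.ext
  · simp [Complex.mul_re, Complex.mul_im]
    nlinarith [h3]
  · simp [Complex.mul_re, Complex.mul_im]
    ring

/-- **The `𝕋`-edge crossed by a mid-edge is `2√3 i` times the dart** `mid - centre`. -/
theorem edge_eq_dart (v : HexVertex) (k : Fin 3) :
    triEmbed (triVert v (k + 1)) - triEmbed (triVert v k) =
      2 * (Real.sqrt 3 : ℂ) * I * (hexMidpoint s(v, hexNbr v k) - hexCenter v) := by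
  rw [edge_eq, hexMidpoint_sub_hexCenter, dartCoeff_eq, pow_succ]
  linear_combination (-(faceSign v * omg ^ (k : ℕ) / 6)) * two_sqrt_three_I_mul

/-! ### Increments of a potential along the edges of `Δ_v` -/

/-- **Increment of a potential along the `k`-th edge of `Δ_v`**: it is the dart value
`(hexMidpoint {v, hexNbr v k} - hexCenter v) · F{v, hexNbr v k}`. -/
theorem increment {Λ : Finset HexVertex} {a : Sym2 HexVertex} {H : Site 2 → ℂ}
    (hH : IsPotential Λ a H) {v : HexVertex} (hv : v ∈ Λ) (k : Fin 3) :
    H (triVert v (k + 1)) - H (triVert v k) =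
      (hexMidpoint s(v, hexNbr v k) - hexCenter v) * Fobs Λ a s(v, hexNbr v k) :=
  hH v hv (hexNbr v k) (adj_hexNbr v k) _ _ (triVert_mem v k) (triVert_mem v (k + 1))
    (triVert_mem_nbr v k) (triVert_succ_mem_nbr v k) (triVert_ne_succ v k) (triVert_oriented v k)

/-- The increment in mode form: `H (z_{k+1}) - H (z_k) = dartCoeff v · ω^k · F_k`. -/
theorem increment_eq {Λ : Finset HexVertex} {a : Sym2 HexVertex} {H : Site 2 → ℂ}
    (hH : IsPotential Λ a H) {v : HexVertex} (hv : v ∈ Λ) (k : Fin 3) :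
    H (triVert v (k + 1)) - H (triVert v k) =
      dartCoeff v * omg ^ (k : ℕ) * Fobs Λ a s(v, hexNbr v k) := by
  rw [increment hH hv k, hexMidpoint_sub_hexCenter]

/-! ### The affine dictionary -/

/-- The `∂`-constant: `cα = (1 + ζ) ω² / 18 = -i√3/18 = 1/(6√3 i)` (`ΣF = 6√3 i ∂H`). -/
def cAlpha : ℂ := (1 + triZeta) * omg ^ 2 / 18

/-- The `∂̄`-constant: `cβ = (1 + ζ) ω / 18 = -1/12 + i√3/36 = -ζ cα`. -/
def cBeta : ℂ := (1 + triZeta) * omg / 18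

/-- **`∂H` on `Δ_v`**: `α(v) = cα · S(v)`, `S = modeSum` the `∂H`-mode. -/
def alpha (F : Sym2 HexVertex → ℂ) (v : HexVertex) : ℂ := cAlpha * modeSum F v

/-- **`∂̄H` on `Δ_v`**: `β(v) = cβ · B(v)`, `B = belt` the Beltrami mode. -/
def beta (F : Sym2 HexVertex → ℂ) (v : HexVertex) : ℂ := cBeta * belt F v

/-- `cα = -(1 + 2ω)/18`. -/
theorem cAlpha_eq' : cAlpha = -(1 + 2 * omg) / 18 := by
  have hp := one_add_omg_add_sq
  rw [cAlpha, triZeta_eq_one_add_omg]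
  linear_combination ((omg + 1) / 18) * hp

/-- `cβ = (ω - 1)/18`. -/
theorem cBeta_eq' : cBeta = (omg - 1) / 18 := by
  have hp := one_add_omg_add_sq
  rw [cBeta, triZeta_eq_one_add_omg]
  linear_combination (1 / 18 : ℂ) * hp

/-- `cα = -i√3/18`. -/
theorem cAlpha_eq : cAlpha = ⟨0, -(Real.sqrt 3 / 18)⟩ := by
  rw [cAlpha_eq', omg_eq]
  apply Complex.ext
  · simp [Complex.div_ofNat_re]
    norm_num
  · simp [Complex.div_ofNat_im]
    ring

/-- `cβ = -1/12 + i√3/36`. -/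
theorem cBeta_eq : cBeta = ⟨-(1 / 12), Real.sqrt 3 / 36⟩ := by
  rw [cBeta_eq', omg_eq]
  apply Complex.ext
  · simp [Complex.div_ofNat_re]
    norm_num
  · simp [Complex.div_ofNat_im]
    ring

/-- `cβ = -ζ · cα`. -/
theorem cBeta_eq_neg_triZeta_mul : cBeta = -triZeta * cAlpha := by
  have hp := one_add_omg_add_sq
  rw [cBeta_eq', cAlpha_eq', triZeta_eq_one_add_omg]
  linear_combination (-1 / 9 : ℂ) * hp

/-- `‖1 + ζ‖ = √3`. -/
theorem norm_one_add_triZeta : ‖(1 + triZeta : ℂ)‖ = Real.sqrt 3 := by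
  have h3 : Real.sqrt 3 ^ 2 = 3 := Real.sq_sqrt (by norm_num)
  rw [Complex.norm_eq_sqrt_sq_add_sq]
  congr 1
  rw [triZeta_eq]
  simp only [Complex.add_re, Complex.one_re, Complex.add_im, Complex.one_im]
  nlinarith [h3]

/-- `‖cα‖ = √3/18`. -/
theorem norm_cAlpha : ‖cAlpha‖ = Real.sqrt 3 / 18 := by
  rw [cAlpha, norm_div, norm_mul, norm_pow, norm_omg, norm_one_add_triZeta]
  simp

/-- `‖cβ‖ = √3/18`. -/
theorem norm_cBeta : ‖cBeta‖ = Real.sqrt 3 / 18 := by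
  rw [cBeta, norm_div, norm_mul, norm_omg, norm_one_add_triZeta]
  simp

/-- `cα ≠ 0`. -/
theorem cAlpha_ne_zero : cAlpha ≠ 0 := by
  rw [← norm_pos_iff, norm_cAlpha]
  positivity

/-- `cβ ≠ 0`. -/
theorem cBeta_ne_zero : cBeta ≠ 0 := by
  rw [← norm_pos_iff, norm_cBeta]
  positivity

/-- `α(v) = 0 ↔ S(v) = 0`. -/
theorem alpha_eq_zero_iff (F : Sym2 HexVertex → ℂ) (v : HexVertex) :
    alpha F v = 0 ↔ modeSum F v = 0 := by
  simp [alpha, cAlpha_ne_zero]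

/-- `β(v) = 0 ↔ B(v) = 0`. -/
theorem beta_eq_zero_iff (F : Sym2 HexVertex → ℂ) (v : HexVertex) :
    beta F v = 0 ↔ belt F v = 0 := by
  simp [beta, cBeta_ne_zero]

/-- The algebraic core of the affine dictionary: with the Lemma-1 mode vanishing, the three dart
values `σ (1 + ζ)/6 · ω^k F_k` are the increments of the real-linear map `e ↦ cα S e + cβ B ē`
along the three edges `e = σ ω^{k+1}` of the triangle (a polynomial identity in `ω` modulo
`1 + ω + ω² = 0` and `F₀ + ωF₁ + ω²F₂ = 0`). -/
theorem affine_alg (σ : ℂ) (F : Fin 3 → ℂ) (hL : F 0 + omg * F 1 + omg ^ 2 * F 2 = 0)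
    (k : Fin 3) :
    σ * ((1 + (1 + omg)) / 6) * omg ^ (k : ℕ) * F k =
      (1 + (1 + omg)) * omg ^ 2 / 18 * (F 0 + F 1 + F 2) * (σ * omg ^ ((k : ℕ) + 1)) +
        (1 + (1 + omg)) * omg / 18 * (F 0 + omg ^ 2 * F 1 + omg * F 2) *
          (σ * (omg ^ 2) ^ ((k : ℕ) + 1)) := by
  have hp := one_add_omg_add_sq
  fin_cases k
  · simp only [Fin.zero_eta]
    linear_combination (σ * (2 + omg) / 18) * hL +
      (σ * (2 + omg) / 18 * ((2 - 2 * omg) * F 0 + (-omg ^ 3 + omg ^ 2 - omg) * F 1 +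
        (-omg ^ 2) * F 2)) * hp
  · simp only [Fin.mk_one]
    linear_combination (σ * (2 + omg) / 18) * hL +
      (σ * (2 + omg) / 18 * ((-omg ^ 3 + omg - 1) * F 0 +
        (-omg ^ 5 + omg ^ 4 - 2 * omg ^ 2 + 2 * omg) * F 1 +
        (-omg ^ 4 + omg ^ 3 - omg ^ 2) * F 2)) * hp
  · simp only [Fin.reduceFinMk]
    linear_combination (σ * (2 + omg) / 18) * hL +
      (σ * (2 + omg) / 18 * (-(omg ^ 5 - omg ^ 4 + omg ^ 3 - omg + 1) * F 0 +
        (-omg ^ 7 + omg ^ 6 - omg ^ 4 + omg ^ 2 - omg) * F 1 +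
        (-omg ^ 6 + omg ^ 5 - 2 * omg ^ 3 + 2 * omg ^ 2) * F 2)) * hp

/-- **The affine dictionary.** For a potential `H` of `F = Fobs Λ a` (`Λ` simply connected, `a`
a boundary mid-edge) and `v ∈ Λ`, the increments of `H` along the three edges of `Δ_v` are those
of the real-affine map `z ↦ α(v) z + β(v) z̄` with `α(v) = cα S(v)` (`∂H ∝ modeSum`) and
`β(v) = cβ B(v)` (`∂̄H ∝ belt`): `H` IS affine on `Δ_v` with these coefficients. Uses DCS Lemma 1
(`NB.lemma1_mode`) to kill the third Fourier mode. -/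
theorem affine {Λ : Finset HexVertex} (hΛ : hexDomainSimplyConnected Λ) {a : Sym2 HexVertex}
    (ha : a ∈ hexDomainBoundary Λ) {H : Site 2 → ℂ} (hH : IsPotential Λ a H) {v : HexVertex}
    (hv : v ∈ Λ) (k : Fin 3) :
    H (triVert v (k + 1)) - H (triVert v k) =
      alpha (Fobs Λ a) v * (triEmbed (triVert v (k + 1)) - triEmbed (triVert v k)) +
        beta (Fobs Λ a) v * conj (triEmbed (triVert v (k + 1)) - triEmbed (triVert v k)) := by
  have hL := lemma1_mode hΛ ha hv
  have key := affine_alg (faceSign v) (fun j => Fobs Λ a s(v, hexNbr v j)) hL k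
  rw [increment_eq hH hv k, edge_eq v k, dartCoeff_eq v, map_mul, map_pow, conj_faceSign,
    conj_omg]
  simp only [alpha, beta, modeSum, belt, cAlpha, cBeta, triZeta_eq_one_add_omg]
  linear_combination key

/-! ### Registered entry points (∀-telescopes) -/

/-- **L1a (registered form).** The increments of a potential along the edges of `Δ_v` are the dart
values. -/
theorem dev_increment : ∀ {Λ : Finset HexVertex} {a : Sym2 HexVertex} {H : Site 2 → ℂ}, IsPotential Λ a H → ∀ {v : HexVertex}, v ∈ Λ → ∀ k : Fin 3, H (triVert v (k + 1)) - H (triVert v k) = (hexMidpoint s(v, hexNbr v k) - hexCenter v) * Fobs Λ a s(v, hexNbr v k) :=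
  fun hH _ hv k => increment hH hv k

/-- **L1b (registered form): the affine dictionary** `dH = α dz + β dz̄` on `Δ_v`,
`α = cAlpha · modeSum`, `β = cBeta · belt`. -/
theorem dev_affine : ∀ {Λ : Finset HexVertex}, hexDomainSimplyConnected Λ → ∀ {a : Sym2 HexVertex}, a ∈ hexDomainBoundary Λ → ∀ {H : Site 2 → ℂ}, IsPotential Λ a H → ∀ {v : HexVertex}, v ∈ Λ → ∀ k : Fin 3, H (triVert v (k + 1)) - H (triVert v k) = alpha (Fobs Λ a) v * (triEmbed (triVert v (k + 1)) - triEmbed (triVert v k)) + beta (Fobs Λ a) v * (starRingEnd ℂ) (triEmbed (triVert v (k + 1)) - triEmbed (triVert v k)) :=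
  fun hΛ _ ha _ hH _ hv k => affine hΛ ha hH hv k

end Dev

end Summit.CriticalPhenomena.SAWScalingLimit.Cruxes.QCIdentification.EightFifthsPrimitive

end
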